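import Literature.Probability.Percolation.StripWindows
import Literature.Probability.Percolation.CutBlocks
import HarnessLib

/-!
# The strips of a family of separated pieces: blocks, thickening, components

Topic `Probability/Percolation`.  Support file (definitions and proofs, no named fact) for the zone
geometry of the proof of Schramm–Smirnov's Prop. 4.1 (Ann. Probab. 39 (2011), §4), per-strip form.
The continuum input is abstracted (`PieceData`): finitely many PIECES `P m ⊆ ℂ` (the pieces of the
cut between the junction squares) pairwise at distance `≥ g > 8 s_b`, finitely many CORES (block
boxes, pairwise not near), and the finite set `T` of non-core blocks whose closed square meets a
piece.  From it: the thickening `T⁺` (non-core blocks near a block of `T`), its 4-components, and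
the resulting `StripData` (`PieceData.stripData`: strips = components, `S_conn`/`S_sep` by
construction, cores as given).  The metric content: every component lies within two blocks of ONE
piece (`exists_piece_of_strip`: adjacent thickened blocks near two pieces would bring the pieces
within `8 s_b < g`), and all eight neighbours of a block meeting a piece lie in the filling of its
strip (`near_mem_F_of_mem_T`: the cut never meets the collar).

## References

* O. Schramm, S. Smirnov, Ann. Probab. 39 (2011), arXiv:1101.5820, §4, proof of Prop. 4.1 (the
  strips `K_j` and the discs at the junctions). [SchrammSmirnov2011]
-/

noncomputable section

open Set Relation Complex
open scoped Classical

namespace Literature.Probability.Percolation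

namespace FineBlocks

/-! ### Boxes of blocks -/

/-- Blocks of a product box are joined inside it. [folklore] -/
theorem conn_prod {a b a' b' : ℤ} {z w : ℤ × ℤ} (hz : z ∈ Finset.Icc a b ×ˢ Finset.Icc a' b')
    (hw : w ∈ Finset.Icc a b ×ˢ Finset.Icc a' b') : Conn ↑(Finset.Icc a b ×ˢ Finset.Icc a' b') z w := by
  simp only [Finset.mem_product, Finset.mem_Icc] at hz hw
  have mem : ∀ {p : ℤ × ℤ}, a ≤ p.1 → p.1 ≤ b → a' ≤ p.2 → p.2 ≤ b' →
      p ∈ (↑(Finset.Icc a b ×ˢ Finset.Icc a' b') : Set (ℤ × ℤ)) := fun h1 h2 h3 h4 =>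
    Finset.mem_coe.2 (Finset.mem_product.2 ⟨Finset.mem_Icc.2 ⟨h1, h2⟩, Finset.mem_Icc.2 ⟨h3, h4⟩⟩)
  have horiz : Conn ↑(Finset.Icc a b ×ˢ Finset.Icc a' b') z (w.1, z.2) := by
    rcases le_total z.1 w.1 with hle | hle
    · have := conn_right (S := ↑(Finset.Icc a b ×ˢ Finset.Icc a' b')) z (w.1 - z.1).toNat fun i hi =>
        mem (by simp only; omega) (by simp only; omega) hz.2.1 hz.2.2
      rwa [show z.1 + ((w.1 - z.1).toNat : ℕ) = w.1 by omega] at this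
    · have := conn_left (S := ↑(Finset.Icc a b ×ˢ Finset.Icc a' b')) z (z.1 - w.1).toNat fun i hi =>
        mem (by simp only; omega) (by simp only; omega) hz.2.1 hz.2.2
      rwa [show z.1 - ((z.1 - w.1).toNat : ℕ) = w.1 by omega] at this
  have vert : Conn ↑(Finset.Icc a b ×ˢ Finset.Icc a' b') (w.1, z.2) w := by
    rcases le_total z.2 w.2 with hle | hle
    · have := conn_up (S := ↑(Finset.Icc a b ×ˢ Finset.Icc a' b')) (w.1, z.2) (w.2 - z.2).toNat fun i hi =>
        mem hw.1.1 hw.1.2 (by simp only; omega) (by simp only; omega)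
      rwa [show ((w.1, z.2) : ℤ × ℤ).2 + ((w.2 - z.2).toNat : ℕ) = w.2 by simp only; omega] at this
    · have := conn_down (S := ↑(Finset.Icc a b ×ˢ Finset.Icc a' b')) (w.1, z.2) (z.2 - w.2).toNat fun i hi =>
        mem hw.1.1 hw.1.2 (by simp only; omega) (by simp only; omega)
      rwa [show ((w.1, z.2) : ℤ × ℤ).2 - ((z.2 - w.2).toNat : ℕ) = w.2 by simp only; omega] at this
  exact horiz.trans vert

/-! ### Points of near blocks are close -/

/-- Coordinates of points of blocks at sup-distance `≤ k` differ by at most `(k + 1) s`. [folklore] -/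
theorem abs_sub_le_of_mem_block {s : ℝ} (hs : 0 < s) {x y : ℂ} {Z W : ℤ × ℤ} (hx : x ∈ CutBlocks.block s Z)
    (hy : y ∈ CutBlocks.block s W) {k : ℕ} (h1 : |Z.1 - W.1| ≤ k) (h2 : |Z.2 - W.2| ≤ k) :
    |x.re - y.re| ≤ (k + 1) * s ∧ |x.im - y.im| ≤ (k + 1) * s := by
  obtain ⟨a1, a2, a3, a4⟩ := hx
  obtain ⟨b1, b2, b3, b4⟩ := hy
  rw [abs_le] at h1 h2
  obtain ⟨h1, h1'⟩ := h1
  obtain ⟨h2, h2'⟩ := h2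
  have e1 : ((Z.1 : ℤ) : ℝ) - W.1 ≤ k := by exact_mod_cast h1'
  have e1' : -(k : ℝ) ≤ ((Z.1 : ℤ) : ℝ) - W.1 := by exact_mod_cast h1
  have e2 : ((Z.2 : ℤ) : ℝ) - W.2 ≤ k := by exact_mod_cast h2'
  have e2' : -(k : ℝ) ≤ ((Z.2 : ℤ) : ℝ) - W.2 := by exact_mod_cast h2
  constructor <;> rw [abs_le] <;> constructor <;> nlinarith

/-- The distance of points of blocks at sup-distance `≤ 3` is at most `8 s`. [folklore] -/
theorem dist_le_of_mem_block {s : ℝ} (hs : 0 < s) {x y : ℂ} {Z W : ℤ × ℤ} (hx : x ∈ CutBlocks.block s Z)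
    (hy : y ∈ CutBlocks.block s W) (h1 : |Z.1 - W.1| ≤ 3) (h2 : |Z.2 - W.2| ≤ 3) : dist x y ≤ 8 * s := by
  obtain ⟨hre, him⟩ := abs_sub_le_of_mem_block hs hx hy (k := 3) (by exact_mod_cast h1) (by exact_mod_cast h2)
  rw [dist_eq_norm]
  have := Complex.norm_le_abs_re_add_abs_im (x - y)
  rw [Complex.sub_re, Complex.sub_im] at this
  norm_num at hre him
  linarith

/-! ### The piece data -/

/-- **Piece data**: block side `sb`, finitely many pieces pairwise at distance `≥ g > 8 sb`,
finitely many core boxes pairwise not near, and the finite set `T` of the non-core blocks whose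
closed square meets a piece. [cite: SchrammSmirnov2011, §4, proof of Prop. 4.1 (the strips between the discs)] -/
structure PieceData where
  /-- block side -/
  sb : ℝ
  hsb : 0 < sb
  /-- number of pieces -/
  N : ℕ
  /-- the pieces -/
  P : Fin N → Set ℂ
  /-- separation of the pieces -/
  g : ℝ
  hg : 8 * sb < g
  far : ∀ m m', m ≠ m' → ∀ x ∈ P m, ∀ y ∈ P m', g ≤ dist x y
  /-- number of cores -/
  M : ℕ
  /-- the cores (block boxes) -/
  C : Fin M → Finset (ℤ × ℤ)
  C_prod : ∀ c, ∃ a b a' b', C c = Finset.Icc a b ×ˢ Finset.Icc a' b'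
  C_sep : ∀ c c', c ≠ c' → ∀ a ∈ C c, ∀ b ∈ C c', ¬ Near a b
  /-- the non-core blocks meeting a piece -/
  T : Finset (ℤ × ℤ)
  mem_T_iff : ∀ Z, Z ∈ T ↔ (∀ c, Z ∉ C c) ∧ ∃ m, (CutBlocks.block sb Z ∩ P m).Nonempty

namespace PieceData

variable (𝔓 : PieceData)

/-- Not a core block. [folklore] -/
def NotCore (Z : ℤ × ℤ) : Prop := ∀ c, Z ∉ 𝔓.C c

/-- **The thickening `T⁺`**: non-core blocks near a block of `T`. [folklore] -/
def Tplus : Finset (ℤ × ℤ) :=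
  (𝔓.T.biUnion fun Z => Finset.Icc (Z.1 - 1) (Z.1 + 1) ×ˢ Finset.Icc (Z.2 - 1) (Z.2 + 1)).filter fun W => 𝔓.NotCore W

variable {𝔓} {Z W : ℤ × ℤ}

/-- `mem_Tplus_iff` (mem Tplus iff). [folklore] -/
theorem mem_Tplus_iff : W ∈ 𝔓.Tplus ↔ 𝔓.NotCore W ∧ ∃ Z ∈ 𝔓.T, Near Z W := by
  simp only [Tplus, Finset.mem_filter, Finset.mem_biUnion, Finset.mem_product, Finset.mem_Icc, Near, abs_le]
  constructor
  · rintro ⟨⟨Z, hZ, ⟨h1, h2⟩, h3, h4⟩, hc⟩; exact ⟨hc, Z, hZ, ⟨by omega, by omega⟩, by omega, by omega⟩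
  · rintro ⟨hc, Z, hZ, ⟨h1, h2⟩, h3, h4⟩; exact ⟨⟨Z, hZ, ⟨by omega, by omega⟩, by omega, by omega⟩, hc⟩

/-- `T ⊆ T⁺`. [folklore] -/
theorem T_subset_Tplus : 𝔓.T ⊆ 𝔓.Tplus := fun Z hZ =>
  mem_Tplus_iff.2 ⟨((𝔓.mem_T_iff Z).1 hZ).1, Z, hZ, near_refl Z⟩

/-- The box property of the cores, all orientations. [folklore] -/
theorem C_box' (c : Fin 𝔓.M) {x y : ℤ × ℤ} (hx : x ∈ 𝔓.C c) (hy : y ∈ 𝔓.C c) :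
    (x.1, y.2) ∈ 𝔓.C c := by
  obtain ⟨a, b, a', b', hC⟩ := 𝔓.C_prod c
  rw [hC, Finset.mem_product, Finset.mem_Icc, Finset.mem_Icc] at hx hy ⊢
  exact ⟨hx.1, hy.2⟩

/-- The cores are 4-connected. [folklore] -/
theorem C_conn (c : Fin 𝔓.M) : ∀ x ∈ 𝔓.C c, ∀ y ∈ 𝔓.C c, Conn ↑(𝔓.C c) x y := by
  obtain ⟨a, b, a', b', hC⟩ := 𝔓.C_prod c
  intro x hx y hy
  rw [hC] at hx hy ⊢
  exact conn_prod hx hy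

/-- Near core blocks lie in one core. [folklore] -/
theorem core_eq_of_near' {c c' : Fin 𝔓.M} {x y : ℤ × ℤ} (hx : x ∈ 𝔓.C c) (hy : y ∈ 𝔓.C c') (h : Near x y) : c = c' := by
  by_contra hne; exact 𝔓.C_sep c c' hne x hx y hy h

/-! ### Components of the thickening -/

variable (𝔓) in
/-- The 4-component of a block of the thickening. [folklore] -/
def comp (Z : ℤ × ℤ) : Finset (ℤ × ℤ) := 𝔓.Tplus.filter fun W => Conn ↑𝔓.Tplus Z W

/-- `mem_comp_iff` (mem comp iff). [folklore] -/
theorem mem_comp_iff (hZ : Z ∈ 𝔓.Tplus) : W ∈ 𝔓.comp Z ↔ Conn ↑𝔓.Tplus Z W := by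
  rw [comp, Finset.mem_filter]
  exact ⟨fun h => h.2, fun h => ⟨h.mem hZ, h⟩⟩

/-- A chain in the thickening from `Z` stays in the component of `Z`. [folklore] -/
theorem conn_comp_of_conn (hZ : Z ∈ 𝔓.Tplus) (h : Conn ↑𝔓.Tplus Z W) : Conn ↑(𝔓.comp Z) Z W := by
  refine h.symm.head_induction (P := fun V => Conn ↑(𝔓.comp Z) Z V) conn_refl fun x y hx hy hxy hya ih => ?_
  have hZy : Conn ↑𝔓.Tplus Z y := hya.symm
  have hZx : Conn ↑𝔓.Tplus Z x := hZy.trans (conn_single hy hx hxy.symm)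
  -- induction is from the end `Z` backwards: we have `Conn comp Z y`?  use `ih : Conn ↑comp Z y`
  exact ih.trans (conn_single ((mem_comp_iff hZ).2 hZy) ((mem_comp_iff hZ).2 hZx) hxy.symm)

/-- Components are equal or disjoint: a common block makes them equal. [folklore] -/
theorem comp_eq_of_mem (hZ : Z ∈ 𝔓.Tplus) (hW : W ∈ 𝔓.Tplus) {V : ℤ × ℤ} (hV : V ∈ 𝔓.comp Z) (hV' : V ∈ 𝔓.comp W) :
    𝔓.comp Z = 𝔓.comp W := by
  have hZW : Conn ↑𝔓.Tplus Z W := ((mem_comp_iff hZ).1 hV).trans ((mem_comp_iff hW).1 hV').symm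
  ext U
  rw [mem_comp_iff hZ, mem_comp_iff hW]
  exact ⟨fun h => hZW.symm.trans h, fun h => hZW.trans h⟩

variable (𝔓) in
/-- The set of components (the strips). [folklore] -/
def strips : Finset (Finset (ℤ × ℤ)) := 𝔓.Tplus.image 𝔓.comp

variable (𝔓) in
/-- **The strip data of the piece data**: strips = 4-components of the thickening, cores as given.
[cite: SchrammSmirnov2011, §4, proof of Prop. 4.1 (the strips K_j and the discs)] -/
def stripData : StripData where
  n := 𝔓.strips.card
  m := 𝔓.M
  S k := (𝔓.strips.equivFin.symm k).1
  C := 𝔓.C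
  S_conn k := by
    obtain ⟨Z, hZ, hZk⟩ := Finset.mem_image.1 (𝔓.strips.equivFin.symm k).2
    intro a ha b hb
    rw [← hZk] at ha hb ⊢
    have ha' := (mem_comp_iff hZ).1 ha
    have hb' := (mem_comp_iff hZ).1 hb
    exact (conn_comp_of_conn hZ ha').symm.trans (conn_comp_of_conn hZ hb')
  S_nonempty k := by
    obtain ⟨Z, hZ, hZk⟩ := Finset.mem_image.1 (𝔓.strips.equivFin.symm k).2
    exact ⟨Z, hZk ▸ (mem_comp_iff hZ).2 conn_refl⟩
  S_sep k j hkj := by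
    obtain ⟨Z, hZ, hZk⟩ := Finset.mem_image.1 (𝔓.strips.equivFin.symm k).2
    obtain ⟨W, hW, hWj⟩ := Finset.mem_image.1 (𝔓.strips.equivFin.symm j).2
    have hne : 𝔓.comp Z ≠ 𝔓.comp W := by
      intro h
      apply hkj
      apply 𝔓.strips.equivFin.symm.injective
      exact Subtype.ext (hZk.symm.trans (h.trans hWj))
    intro a ha b hb
    rw [← hZk] at ha
    rw [← hWj] at hb
    refine ⟨fun hab => hne (comp_eq_of_mem hZ hW ha (hab ▸ hb)), fun hab => hne (comp_eq_of_mem hZ hW ha ?_)⟩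
    exact (mem_comp_iff hW).2 (((mem_comp_iff hW).1 hb).trans
      (conn_single (Finset.mem_filter.1 hb).1 (Finset.mem_filter.1 ha).1 hab.symm))
  S_C k c a ha := by
    obtain ⟨Z, hZ, hZk⟩ := Finset.mem_image.1 (𝔓.strips.equivFin.symm k).2
    rw [← hZk] at ha
    exact (mem_Tplus_iff.1 (Finset.mem_filter.1 ha).1).1 c
  C_sep := 𝔓.C_sep
  C_box c x y h1 h2 := by
    simpa using 𝔓.C_box' c h1 h2
  C_conn := 𝔓.C_conn

/-- The strips of the strip data are components of the thickening. [folklore] -/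
theorem exists_comp_eq (k : Fin 𝔓.stripData.n) : ∃ Z ∈ 𝔓.Tplus, 𝔓.stripData.S k = 𝔓.comp Z := by
  obtain ⟨Z, hZ, hZk⟩ := Finset.mem_image.1 (𝔓.strips.equivFin.symm k).2
  exact ⟨Z, hZ, hZk.symm⟩

/-- Every block of the thickening lies in some strip. [folklore] -/
theorem exists_mem_S (hZ : Z ∈ 𝔓.Tplus) : ∃ k : Fin 𝔓.stripData.n, Z ∈ 𝔓.stripData.S k := by
  have hmem : 𝔓.comp Z ∈ 𝔓.strips := Finset.mem_image.2 ⟨Z, hZ, rfl⟩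
  refine ⟨𝔓.strips.equivFin ⟨_, hmem⟩, ?_⟩
  show Z ∈ (𝔓.strips.equivFin.symm (𝔓.strips.equivFin ⟨_, hmem⟩)).1
  rw [Equiv.symm_apply_apply]
  exact (mem_comp_iff hZ).2 conn_refl

/-- Strips lie in the thickening. [folklore] -/
theorem S_subset_Tplus (k : Fin 𝔓.stripData.n) : 𝔓.stripData.S k ⊆ 𝔓.Tplus := by
  obtain ⟨Z, hZ, hk⟩ := exists_comp_eq k
  rw [hk]; exact Finset.filter_subset _ _

/-! ### Every strip follows one piece -/

/-- A block of the thickening is **near the piece** `m`. [folklore] -/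
def NearPiece (𝔓 : PieceData) (Z : ℤ × ℤ) (m : Fin 𝔓.N) : Prop :=
  ∃ Z' ∈ 𝔓.T, Near Z Z' ∧ (CutBlocks.block 𝔓.sb Z' ∩ 𝔓.P m).Nonempty

/-- Every block of the thickening is near some piece. [folklore] -/
theorem exists_nearPiece (hZ : Z ∈ 𝔓.Tplus) : ∃ m, 𝔓.NearPiece Z m := by
  obtain ⟨-, Z', hZ', hnear⟩ := mem_Tplus_iff.1 hZ
  obtain ⟨-, m, hm⟩ := (𝔓.mem_T_iff Z').1 hZ'
  exact ⟨m, Z', hZ', hnear.symm, hm⟩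

/-- **Equal or adjacent blocks of the thickening are near the same piece only**: the two pieces have
points within `8 sb < g`. [folklore] -/
theorem piece_eq_of_nearPiece {m m' : Fin 𝔓.N} (hZ : 𝔓.NearPiece Z m) (hW : 𝔓.NearPiece W m')
    (hZW : Z = W ∨ OneStep Z W) : m = m' := by
  by_contra hne
  obtain ⟨Z', -, hZZ', x, hx, hxm⟩ := hZ
  obtain ⟨W', -, hWW', y, hy, hym⟩ := hW
  have hZW' : |Z.1 - W.1| ≤ 1 ∧ |Z.2 - W.2| ≤ 1 := by
    rcases hZW with rfl | h
    · simp
    · exact h.near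
  have h1 : |Z'.1 - W'.1| ≤ 3 := by
    have a := hZZ'.1; have b := hWW'.1; have c := hZW'.1
    rw [abs_le] at a b c ⊢; omega
  have h2 : |Z'.2 - W'.2| ≤ 3 := by
    have a := hZZ'.2; have b := hWW'.2; have c := hZW'.2
    rw [abs_le] at a b c ⊢; omega
  have hd := dist_le_of_mem_block 𝔓.hsb hx hy h1 h2
  have := 𝔓.far m m' hne x hxm y hym
  linarith [𝔓.hg]

/-- **Every strip follows one piece**: all its blocks are near the same piece. [folklore] -/
theorem exists_piece_of_strip (k : Fin 𝔓.stripData.n) : ∃ m, ∀ Z ∈ 𝔓.stripData.S k, 𝔓.NearPiece Z m := by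
  obtain ⟨Z₀, hZ₀, hk⟩ := exists_comp_eq k
  obtain ⟨m, hm⟩ := exists_nearPiece hZ₀
  refine ⟨m, fun Z hZ => ?_⟩
  rw [hk] at hZ
  have h := (mem_comp_iff hZ₀).1 hZ
  refine h.symm.head_induction (P := fun V => 𝔓.NearPiece V m) hm fun x y hx _ hxy _ hy => ?_
  obtain ⟨m', hm'⟩ := exists_nearPiece hx
  exact (piece_eq_of_nearPiece hm' hy (Or.inr hxy)) ▸ hm'

/-! ### The neighbourhood of a block meeting a piece -/

/-- **All non-core blocks near a block of `T` lie in its component.** (A diagonal neighbour is reached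
through a side neighbour: two perpendicular side neighbours cannot both be core blocks, by the box
property.) [folklore] -/
theorem conn_of_near_of_mem_T (hZ : Z ∈ 𝔓.T) (hW : 𝔓.NotCore W) (h : Near Z W) : Conn ↑𝔓.Tplus Z W := by
  have hZp : Z ∈ 𝔓.Tplus := T_subset_Tplus hZ
  have memW : ∀ {V}, 𝔓.NotCore V → Near Z V → V ∈ (↑𝔓.Tplus : Set (ℤ × ℤ)) := fun hV hZV =>
    Finset.mem_coe.2 (mem_Tplus_iff.2 ⟨hV, Z, hZ, hZV⟩)
  obtain ⟨h1, h2⟩ := h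
  rw [abs_le] at h1 h2
  -- offsets
  obtain ⟨dx, hdx⟩ : ∃ dx : ℤ, W.1 = Z.1 + dx := ⟨W.1 - Z.1, by ring⟩
  obtain ⟨dy, hdy⟩ : ∃ dy : ℤ, W.2 = Z.2 + dy := ⟨W.2 - Z.2, by ring⟩
  have hW' : W = (Z.1 + dx, Z.2 + dy) := Prod.ext hdx hdy
  subst hW'
  have hdx' : dx = -1 ∨ dx = 0 ∨ dx = 1 := by simp only at h1; omega
  have hdy' : dy = -1 ∨ dy = 0 ∨ dy = 1 := by simp only at h2; omega
  -- side neighbours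
  by_cases hside : dx = 0 ∨ dy = 0
  · rcases hside with rfl | rfl
    · rcases hdy' with rfl | rfl | rfl
      · exact conn_single hZp (memW hW ⟨by simp, by simp⟩) (Or.inl ⟨by simp, by simp⟩)
      · simpa using (conn_refl : Conn ↑𝔓.Tplus Z Z)
      · exact conn_single hZp (memW hW ⟨by simp, by simp⟩) (Or.inl ⟨by simp, by simp⟩)
    · rcases hdx' with rfl | rfl | rfl
      · exact conn_single hZp (memW hW ⟨by simp, by simp⟩) (Or.inr ⟨by simp, by simp⟩)
      · simpa using (conn_refl : Conn ↑𝔓.Tplus Z Z)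
      · exact conn_single hZp (memW hW ⟨by simp, by simp⟩) (Or.inr ⟨by simp, by simp⟩)
  · push Not at hside
    obtain ⟨hdx0, hdy0⟩ := hside
    -- the two side blocks `(Z.1 + dx, Z.2)` and `(Z.1, Z.2 + dy)`; not both are core blocks
    have key : 𝔓.NotCore (Z.1 + dx, Z.2) ∨ 𝔓.NotCore (Z.1, Z.2 + dy) := by
      by_contra hboth
      push Not at hboth
      obtain ⟨h1', h2'⟩ := hboth
      simp only [NotCore, not_forall, not_not] at h1' h2'
      obtain ⟨c, hc⟩ := h1'
      obtain ⟨c', hc'⟩ := h2'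
      have hcc' : c = c' := core_eq_of_near' hc hc' ⟨by simp only; rw [abs_le]; omega, by simp only; rw [abs_le]; omega⟩
      subst hcc'
      exact hW c (by simpa using 𝔓.C_box' c hc hc')
    have hdxabs : |dx| = 1 := by rcases hdx' with rfl | rfl | rfl <;> simp at hdx0 ⊢
    have hdyabs : |dy| = 1 := by rcases hdy' with rfl | rfl | rfl <;> simp at hdy0 ⊢
    rcases key with hs | hs
    · have hs' : (Z.1 + dx, Z.2) ∈ (↑𝔓.Tplus : Set (ℤ × ℤ)) := memW hs ⟨by simp [hdxabs], by simp⟩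
      have hWm : (Z.1 + dx, Z.2 + dy) ∈ (↑𝔓.Tplus : Set (ℤ × ℤ)) :=
        memW hW ⟨by simp [hdxabs], by simp [hdyabs]⟩
      exact (conn_single hZp hs' (Or.inr ⟨by simp, by simp [hdxabs]⟩)).trans
        (conn_single hs' hWm (Or.inl ⟨by simp, by simp [hdyabs]⟩))
    · have hs' : (Z.1, Z.2 + dy) ∈ (↑𝔓.Tplus : Set (ℤ × ℤ)) := memW hs ⟨by simp, by simp [hdyabs]⟩
      have hWm : (Z.1 + dx, Z.2 + dy) ∈ (↑𝔓.Tplus : Set (ℤ × ℤ)) :=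
        memW hW ⟨by simp [hdxabs], by simp [hdyabs]⟩
      exact (conn_single hZp hs' (Or.inl ⟨by simp, by simp [hdyabs]⟩)).trans
        (conn_single hs' hWm (Or.inr ⟨by simp, by simp [hdxabs]⟩))

/-- **All eight neighbours of a block meeting a piece lie in the filling of its strip**: non-core ones
in the strip itself, core ones in an adjacent core. [folklore] -/
theorem near_mem_F_of_mem_T {k : Fin 𝔓.stripData.n} (hZk : Z ∈ 𝔓.stripData.S k) (hZ : Z ∈ 𝔓.T) (h : Near Z W) :
    W ∈ 𝔓.stripData.F k := by
  obtain ⟨Z₀, hZ₀, hk⟩ := exists_comp_eq k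
  have hZ₀Z : Conn ↑𝔓.Tplus Z₀ Z := (mem_comp_iff hZ₀).1 (hk ▸ hZk)
  rw [StripData.mem_F_iff]
  by_cases hW : 𝔓.NotCore W
  · -- in the strip
    have hWk : W ∈ 𝔓.stripData.S k := by
      rw [hk]; exact (mem_comp_iff hZ₀).2 (hZ₀Z.trans (conn_of_near_of_mem_T hZ hW h))
    exact StripData.not_out_of_mem_S hWk
  · -- in an adjacent core: reach it through a side block of `Z`
    simp only [NotCore, not_forall, not_not] at hW
    obtain ⟨c, hc⟩ := hW
    intro hout
    apply hout.not_mem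
    have hc2 : W ∈ 𝔓.stripData.C c := hc
    refine StripData.C_subset_gen (c := c) (StripData.mem_adjC_iff.2 ?_) hc2
    -- a strip block 4-adjacent to a block of the core `c`
    obtain ⟨h1, h2⟩ := h
    rw [abs_le] at h1 h2
    obtain ⟨dx, hdx⟩ : ∃ dx : ℤ, W.1 = Z.1 + dx := ⟨W.1 - Z.1, by ring⟩
    obtain ⟨dy, hdy⟩ : ∃ dy : ℤ, W.2 = Z.2 + dy := ⟨W.2 - Z.2, by ring⟩
    have hW' : W = (Z.1 + dx, Z.2 + dy) := Prod.ext hdx hdy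
    have hdx' : dx = -1 ∨ dx = 0 ∨ dx = 1 := by rw [hdx] at h1; omega
    have hdy' : dy = -1 ∨ dy = 0 ∨ dy = 1 := by rw [hdy] at h2; omega
    have hZnc : 𝔓.NotCore Z := ((𝔓.mem_T_iff Z).1 hZ).1
    have hWZ : W ≠ Z := fun h => hZnc c (h ▸ hc)
    by_cases hside : dx = 0 ∨ dy = 0
    · -- `W` itself is 4-adjacent to `Z`
      refine ⟨Z, hZk, W, hc2, ?_⟩
      rw [hW']
      rcases hside with rfl | rfl
      · have : |dy| = 1 := by
          rcases hdy' with rfl | rfl | rfl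
          · simp
          · exfalso; exact hWZ (by rw [hW']; simp)
          · simp
        exact Or.inl ⟨by simp, by simp [this]⟩
      · have : |dx| = 1 := by
          rcases hdx' with rfl | rfl | rfl
          · simp
          · exfalso; exact hWZ (by rw [hW']; simp)
          · simp
        exact Or.inr ⟨by simp, by simp [this]⟩
    · push Not at hside
      obtain ⟨hdx0, hdy0⟩ := hside
      have hdxabs : |dx| = 1 := by rcases hdx' with rfl | rfl | rfl <;> simp at hdx0 ⊢
      have hdyabs : |dy| = 1 := by rcases hdy' with rfl | rfl | rfl <;> simp at hdy0 ⊢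
      -- the side blocks: if one is a core block it is in core `c` (near `W`), giving a 4-adjacency from `Z`;
      -- otherwise it is a strip block 4-adjacent to `W`
      by_cases hs : 𝔓.NotCore (Z.1 + dx, Z.2)
      · have hsk : (Z.1 + dx, Z.2) ∈ 𝔓.stripData.S k := by
          rw [hk]
          exact (mem_comp_iff hZ₀).2 (hZ₀Z.trans (conn_of_near_of_mem_T hZ hs ⟨by simp [hdxabs], by simp⟩))
        refine ⟨_, hsk, W, hc2, ?_⟩
        rw [hW']; exact Or.inl ⟨by simp, by simp [hdyabs]⟩
      · simp only [NotCore, not_forall, not_not] at hs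
        obtain ⟨c', hc'⟩ := hs
        have hcc' : c' = c := core_eq_of_near' hc' hc ⟨by rw [hW']; simp, by rw [hW']; simp [hdyabs]⟩
        rw [hcc'] at hc'
        exact ⟨Z, hZk, _, (hc' : (Z.1 + dx, Z.2) ∈ 𝔓.stripData.C c), Or.inr ⟨rfl, by simp [hdxabs]⟩⟩

end PieceData

end FineBlocks

end Literature.Probability.Percolation

end
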